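import Summits.ResolutionOfSingularities.ResolutionOfSingularities.Theorems.UniformComplexityCampaignW82FamilyResolutionLinks
import Summits.ResolutionOfSingularities.ResolutionOfSingularities.Theorems.UniformComplexityPrimeModelTransferSmoothFamilySpread
import Summits.ResolutionOfSingularities.ResolutionOfSingularities.Theorems.UniformComplexityPrimeModelTransferOfFamilyResolutionOneFibre
import Summits.ResolutionOfSingularities.ResolutionOfSingularities.Theorems.UniformComplexityPrimeModelTransferSpecialization
import Mathlib.FieldTheory.IsAlgClosed.AlgebraicClosure
import HarnessLib

/-!
# [OURS · L1 W8.2 door 2] THE CRUX `PrimeModelTransfer` IS «ONE SMOOTH CLOSED FIBRE, FLATLY» over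
# `𝔽̄_p` — by-name links (Theses-importing leaf)

Route `ResolutionOfSingularities/UniformComplexity`, crux `PrimeModelTransfer`
(stmt-ResolutionOfSingularities-8933: for a prime `p`, resolution over the algebraically closed fields
algebraic over `𝔽_p` ⇒ resolution over EVERY algebraically closed field of characteristic `p`). Gen 5
of this seat proved the crux slice EQUIVALENT to RESOLUTION IN FAMILIES over `𝔽̄_p`
(`FamilyResolution`, p526769; `primeModelTransfer_iff_familyResolution`, p530650/p532272). Gen 6 typed
two further family forms (`SmoothFamilyResolution`, `FamilyResolutionOneFibre`; module
`Theorems/UniformComplexityCampaignW82FamilyResolutionOneFibre.lean`, p540376) and proved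
`AlgClosedRes p → SmoothFamilyResolution k` (strong spreading, p541728),
`SmoothFamilyResolution k → FamilyResolution k`, `SmoothFamilyResolution k → FamilyResolutionOneFibre k`
and — the E7 direction, EGA IV₃ 12.2.4 (iii) — `FamilyResolutionOneFibre k →` resolution over every
algebraically closed `K ⊇ k` (`PrimeModelTransfer.hasResolution_of_familyResolutionOneFibre`). THIS
FILE records the resulting equivalences BY NAME, for every field `k` of characteristic `p`:

* `algClosedRes_of_forall_isAlgClosed_extension` — resolution over the algebraically closed fields
  receiving `k` ⇒ `AlgClosedRes p` (common algebraically closed extension of `k` and the target field +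
  gen 2's SPECIALIZATION `PrimeModelTransfer.integralResOver_of_integralResOver_extension`, p484634);
* `smoothFamilyResolution_iff_algClosedRes`, `familyResolutionOneFibre_iff_algClosedRes` (with gen 5's
  `familyResolution_iff_algClosedRes`, p532272, all three family forms are `AlgClosedRes p`);
* `familyForms_tfae` — **`[AlgClosedRes p, FamilyResolution k, SmoothFamilyResolution k,
  FamilyResolutionOneFibre k].TFAE`**;
* `algClosedRes_iff_familyResolutionOneFibre` — **resolution of integral varieties over ALL
  algebraically closed fields of characteristic `p` ⟺ for every proper `𝔽̄_p`-family with integral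
  geometric generic fibre: after an algebraic finite-type base extension, SOME proper modification of
  the family, flat along ONE closed fibre and an isomorphism over an open meeting it, has that ONE
  closed fibre — an `𝔽̄_p`-variety — smooth**;
* `primeModelTransferAt_iff_familyResolutionOneFibre`, `primeModelTransfer_iff_familyResolutionOneFibre`
  (route declaration), and the `SmoothFamilyResolution` companions; the closer-shaped
  `primeModelTransfer_of_forall_familyResolutionOneFibre`.

Reading for the slot (W8.2 «transfer FAMILIES, not fibres»; KERNEL-c3 §1): door 2's residual is a
statement about `𝔽̄_p`-schemes ONLY — closed fibres of `𝔽̄_p`-families and flatness — with no imperfect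
field, generic fibre or base change of a regular scheme in it: «resolve ONE general closed fibre of the
(algebraically base-extended) family by a modification of the whole family that is FLAT at that fibre».
The barrier files (`RegularNotGeometricallyRegular.lean`, `FrobeniusTwistResolution.lean`,
`InseparableBaseChangeResolution.lean`) say why the word FLAT cannot be dropped (the fibrewise
resolutions of the original family do not fit into a flat family when the generic fibre is not
smoothable at level `A`), and the census of gens 3–5 (twist exponent unbounded; normalise never
suffices; selection necessary) constrains the base extension `A → A'` and the choice of the
modification.

[OURS · LADDER-RESOLUTION L1, slot W8.2 (prime-field / universality transfer), door 2
UniformComplexity] Theorems over the summit's own route and OURS names; NOT statements of, and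
attributing nothing to, Hironaka's 2017 manuscript (the OURS `Prop`s replace the role of §17 ¶2,
p.89 l.59–62). AI-written; weaker than expert review. Theses-importing LEAF (imports the gen-5 links leaf
`…FamilyResolutionLinks` for `familyResolution_iff_algClosedRes` — the gate's dedup rule forbids
re-deriving it — and otherwise only Theses-free modules); nothing imports this file.
-/

noncomputable section

set_option linter.dupNamespace false -- mandated namespace of this single-conjunct summit

open CategoryTheory CategoryTheory.Limits AlgebraicGeometry TopologicalSpace
open Literature.AlgebraicGeometry.Resolution
open Summit.ResolutionOfSingularities.ResolutionOfSingularities.Theses.UniformComplexity (PrimeModelTransfer)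

namespace Summit.ResolutionOfSingularities.ResolutionOfSingularities.Theorems.CampaignW82

/-! ## Specialization: resolution over the algebraically closed extensions of `k` is `AlgClosedRes p` -/

/-- **From the algebraically closed extensions of ONE field to all algebraically closed fields of the
characteristic.** If `k` has characteristic `p` and every integral separated scheme of finite type over
every algebraically closed field `K` receiving `k` has a resolution, then `AlgClosedRes p`: given an
algebraically closed `K'` of characteristic `p`, let `K` be an algebraic closure of a residue field of
`k ⊗_{𝔽_p} K'` (a non-zero ring) — an algebraically closed field receiving both `k` and `K'`; resolution
descends from `K` to the algebraically closed subfield `K'` by SPECIALIZATION (gen 2's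
`PrimeModelTransfer.integralResOver_of_integralResOver_extension`, p484634). (The frame of gen 5's
`familyResolution_iff_algClosedRes`, p532272, isolated.) [folklore] -/
theorem algClosedRes_of_forall_isAlgClosed_extension (p : ℕ) [Fact p.Prime] (k : Type) [Field k]
    [CharP k p]
    (H : ∀ (K : Type) [Field K] [IsAlgClosed K] [Algebra k K] (Y : Scheme.{0}) (g : Y ⟶ Spec (.of K)),
      IsSeparated g → LocallyOfFiniteType g → QuasiCompact g → IsIntegral Y → Scheme.HasResolution Y) :
    AlgClosedRes p := by
  intro K' _ _ _ X f hs hl hq hX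
  -- a common algebraically closed extension `K` of `k` and `K'`
  letI : Algebra (ZMod p) k := ZMod.algebra k p
  letI : Algebra (ZMod p) K' := ZMod.algebra K' p
  haveI : Nontrivial (TensorProduct (ZMod p) k K') :=
    (Algebra.TensorProduct.includeLeft_injective (R := ZMod p) (S := ZMod p) (A := k) (B := K')
      (algebraMap (ZMod p) K').injective).nontrivial
  obtain ⟨𝔪, h𝔪⟩ := Ideal.exists_maximal (TensorProduct (ZMod p) k K')
  let K₀ : Type := TensorProduct (ZMod p) k K' ⧸ 𝔪
  letI : Field K₀ := Ideal.Quotient.field 𝔪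
  let K : Type := AlgebraicClosure K₀
  let ιk : k →+* K := (algebraMap K₀ K).comp ((Ideal.Quotient.mk 𝔪).comp
    (Algebra.TensorProduct.includeLeft (R := ZMod p) (S := ZMod p) (A := k) (B := K')).toRingHom)
  let ιK' : K' →+* K := (algebraMap K₀ K).comp ((Ideal.Quotient.mk 𝔪).comp
    (Algebra.TensorProduct.includeRight (R := ZMod p) (A := k) (B := K')).toRingHom)
  letI : Algebra k K := ιk.toAlgebra
  letI : Algebra K' K := ιK'.toAlgebra
  haveI : PerfectField K := IsAlgClosed.perfectField K
  exact PrimeModelTransfer.integralResOver_of_integralResOver_extension K' K (H K) X f hs hl hq hX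

/-! ## The three family forms are equivalent to `AlgClosedRes p` -/

/-- **`SmoothFamilyResolution k ↔ AlgClosedRes p`** for every field `k` of characteristic `p`
(→ `PrimeModelTransfer.algClosedRes_of_…`-style: smooth ⇒ one fibre ⇒ resolution over the algebraically
closed extensions of `k` ⇒ `AlgClosedRes p` by `algClosedRes_of_forall_isAlgClosed_extension`;
← `PrimeModelTransfer.smoothFamilyResolution_of_algClosedRes`, p541728). [folklore] -/
theorem smoothFamilyResolution_iff_algClosedRes (p : ℕ) [Fact p.Prime] (k : Type) [Field k]
    [CharP k p] : SmoothFamilyResolution k ↔ AlgClosedRes p := by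
  refine ⟨fun h => algClosedRes_of_forall_isAlgClosed_extension p k fun K _ _ _ Y g hs hl hq hY => ?_,
    fun h => PrimeModelTransfer.smoothFamilyResolution_of_algClosedRes p h k⟩
  haveI := hs; haveI := hl; haveI := hq; haveI := hY
  exact PrimeModelTransfer.hasResolution_of_familyResolutionOneFibre k K
    (PrimeModelTransfer.familyResolutionOneFibre_of_smoothFamilyResolution k h) Y g

/-- **`FamilyResolutionOneFibre k ↔ AlgClosedRes p`** for EVERY field `k` of characteristic `p`
(→ the E7 direction `PrimeModelTransfer.hasResolution_of_familyResolutionOneFibre` over the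
algebraically closed extensions of `k`, then `algClosedRes_of_forall_isAlgClosed_extension`;
← through the strong form). [folklore] -/
theorem familyResolutionOneFibre_iff_algClosedRes (p : ℕ) [Fact p.Prime] (k : Type) [Field k]
    [CharP k p] : FamilyResolutionOneFibre k ↔ AlgClosedRes p := by
  refine ⟨fun h => algClosedRes_of_forall_isAlgClosed_extension p k fun K _ _ _ Y g hs hl hq hY => ?_,
    fun h => PrimeModelTransfer.familyResolutionOneFibre_of_smoothFamilyResolution k
      (PrimeModelTransfer.smoothFamilyResolution_of_algClosedRes p h k)⟩
  haveI := hs; haveI := hl; haveI := hq; haveI := hY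
  exact PrimeModelTransfer.hasResolution_of_familyResolutionOneFibre k K h Y g

/-- `FamilyResolution k ↔ SmoothFamilyResolution k` (both are `AlgClosedRes p`). [folklore] -/
theorem familyResolution_iff_smoothFamilyResolution (p : ℕ) [Fact p.Prime] (k : Type) [Field k]
    [CharP k p] : FamilyResolution k ↔ SmoothFamilyResolution k :=
  (familyResolution_iff_algClosedRes p k).trans (smoothFamilyResolution_iff_algClosedRes p k).symm

/-- `FamilyResolution k ↔ FamilyResolutionOneFibre k` (both are `AlgClosedRes p`): resolving ALL
field-valued fibres simultaneously is equivalent to resolving ONE closed fibre flatly. [folklore] -/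
theorem familyResolution_iff_familyResolutionOneFibre (p : ℕ) [Fact p.Prime] (k : Type) [Field k]
    [CharP k p] : FamilyResolution k ↔ FamilyResolutionOneFibre k :=
  (familyResolution_iff_algClosedRes p k).trans (familyResolutionOneFibre_iff_algClosedRes p k).symm

/-- **THE FOUR FORMS ARE EQUIVALENT.** For a prime `p` and every field `k` of characteristic `p`:
`[AlgClosedRes p, FamilyResolution k, SmoothFamilyResolution k, FamilyResolutionOneFibre k].TFAE` —
resolution over all algebraically closed fields of characteristic `p`; simultaneous weak resolution of
all fibres of `k`-families (after algebraic base extension); a smooth proper modification of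
`k`-families; ONE smooth closed fibre of a proper modification flat along it. [folklore] -/
theorem familyForms_tfae (p : ℕ) [Fact p.Prime] (k : Type) [Field k] [CharP k p] :
    [AlgClosedRes p, FamilyResolution k, SmoothFamilyResolution k, FamilyResolutionOneFibre k].TFAE := by
  tfae_have 1 ↔ 2 := (familyResolution_iff_algClosedRes p k).symm
  tfae_have 1 ↔ 3 := (smoothFamilyResolution_iff_algClosedRes p k).symm
  tfae_have 1 ↔ 4 := (familyResolutionOneFibre_iff_algClosedRes p k).symm
  tfae_finish

/-! ## Over the prime model `𝔽̄_p`, and the crux by name -/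

/-- **`AlgClosedRes p ↔ FamilyResolutionOneFibre (AlgebraicClosure (ZMod p))`**: resolution of
integral varieties over ALL algebraically closed fields of characteristic `p` is EQUIVALENT to: for
every proper family over a finitely generated `𝔽̄_p`-domain with integral geometric generic fibre,
after an algebraic finite-type base extension some proper modification of the family — an isomorphism
over an open meeting the fibre over a closed point `s`, and flat over `s` — has its fibre over `s`, an
`𝔽̄_p`-scheme, smooth. [folklore] -/
theorem algClosedRes_iff_familyResolutionOneFibre (p : ℕ) [Fact p.Prime] :
    AlgClosedRes p ↔ FamilyResolutionOneFibre (AlgebraicClosure (ZMod p)) := by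
  haveI : CharP (AlgebraicClosure (ZMod p)) p :=
    charP_of_injective_algebraMap (algebraMap (ZMod p) (AlgebraicClosure (ZMod p))).injective p
  exact (familyResolutionOneFibre_iff_algClosedRes p (AlgebraicClosure (ZMod p))).symm

/-- `AlgClosedRes p ↔ SmoothFamilyResolution (AlgebraicClosure (ZMod p))`. [folklore] -/
theorem algClosedRes_iff_smoothFamilyResolution (p : ℕ) [Fact p.Prime] :
    AlgClosedRes p ↔ SmoothFamilyResolution (AlgebraicClosure (ZMod p)) := by
  haveI : CharP (AlgebraicClosure (ZMod p)) p :=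
    charP_of_injective_algebraMap (algebraMap (ZMod p) (AlgebraicClosure (ZMod p))).injective p
  exact (smoothFamilyResolution_iff_algClosedRes p (AlgebraicClosure (ZMod p))).symm

/-- **THE CRUX SLICE IS THE ONE-CLOSED-FIBRE FORM OVER THE PRIME MODEL, BY NAME.** For a prime `p`:
`PrimeModelTransferAt p ↔ (PrimeClosureRes p → FamilyResolutionOneFibre (AlgebraicClosure (ZMod p)))`
(`PrimeModelTransferAt p` is `PrimeClosureRes p → AlgClosedRes p` by definition, p481773).
[folklore] -/
theorem primeModelTransferAt_iff_familyResolutionOneFibre (p : ℕ) [Fact p.Prime] :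
    PrimeModelTransferAt p ↔
      (PrimeClosureRes p → FamilyResolutionOneFibre (AlgebraicClosure (ZMod p))) :=
  imp_congr_right fun _ => algClosedRes_iff_familyResolutionOneFibre p

/-- `PrimeModelTransferAt p ↔ (PrimeClosureRes p → SmoothFamilyResolution (AlgebraicClosure (ZMod p)))`.
[folklore] -/
theorem primeModelTransferAt_iff_smoothFamilyResolution (p : ℕ) [Fact p.Prime] :
    PrimeModelTransferAt p ↔
      (PrimeClosureRes p → SmoothFamilyResolution (AlgebraicClosure (ZMod p))) :=
  imp_congr_right fun _ => algClosedRes_iff_smoothFamilyResolution p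

/-- The crux slice with ANY field of characteristic `p` as the family base:
`PrimeModelTransferAt p ↔ (PrimeClosureRes p → FamilyResolutionOneFibre k)`. [folklore] -/
theorem primeModelTransferAt_iff_familyResolutionOneFibre_of_charP (p : ℕ) [Fact p.Prime] (k : Type)
    [Field k] [CharP k p] : PrimeModelTransferAt p ↔ (PrimeClosureRes p → FamilyResolutionOneFibre k) :=
  imp_congr_right fun _ => (familyResolutionOneFibre_iff_algClosedRes p k).symm

/-- **For the route declaration.** `Theses.UniformComplexity.PrimeModelTransfer` holds iff for every
prime `p`, resolution over the algebraically closed fields algebraic over `𝔽_p` implies the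
ONE-CLOSED-FIBRE family form over `𝔽̄_p = AlgebraicClosure (ZMod p)` (the route declaration is
`∀ p, p.Prime → PrimeModelTransferAt p` definitionally, p488474). [folklore] -/
theorem primeModelTransfer_iff_familyResolutionOneFibre :
    PrimeModelTransfer ↔ ∀ (p : ℕ) [Fact p.Prime],
      PrimeClosureRes p → FamilyResolutionOneFibre (AlgebraicClosure (ZMod p)) := by
  change (∀ p : ℕ, p.Prime → PrimeModelTransferAt p) ↔ _
  constructor
  · intro h p hp
    exact (primeModelTransferAt_iff_familyResolutionOneFibre p).mp (h p hp.out)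
  · intro h p hp
    haveI : Fact p.Prime := ⟨hp⟩
    exact (primeModelTransferAt_iff_familyResolutionOneFibre p).mpr (h p)

/-- `Theses.UniformComplexity.PrimeModelTransfer ↔ ∀ p, PrimeClosureRes p →
SmoothFamilyResolution (AlgebraicClosure (ZMod p))`. [folklore] -/
theorem primeModelTransfer_iff_smoothFamilyResolution :
    PrimeModelTransfer ↔ ∀ (p : ℕ) [Fact p.Prime],
      PrimeClosureRes p → SmoothFamilyResolution (AlgebraicClosure (ZMod p)) := by
  change (∀ p : ℕ, p.Prime → PrimeModelTransferAt p) ↔ _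
  constructor
  · intro h p hp
    exact (primeModelTransferAt_iff_smoothFamilyResolution p).mp (h p hp.out)
  · intro h p hp
    haveI : Fact p.Prime := ⟨hp⟩
    exact (primeModelTransferAt_iff_smoothFamilyResolution p).mpr (h p)

/-- **Closer shape.** If, for every prime `p`, resolution over `𝔽̄_p`-type fields (`PrimeClosureRes p`)
yields the ONE-CLOSED-FIBRE family form over `𝔽̄_p`, then the route declaration
`Theses.UniformComplexity.PrimeModelTransfer` holds (a planner filing the right-hand side as a rank-9
item closes stmt-8933 with this term). [folklore] -/
theorem primeModelTransfer_of_forall_familyResolutionOneFibre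
    (h : ∀ (p : ℕ) [Fact p.Prime], PrimeClosureRes p → FamilyResolutionOneFibre (AlgebraicClosure (ZMod p))) :
    PrimeModelTransfer :=
  primeModelTransfer_iff_familyResolutionOneFibre.mpr h

end Summit.ResolutionOfSingularities.ResolutionOfSingularities.Theorems.CampaignW82

end
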